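import Literature.NumberTheory.LFunctions.PartialEulerProducts
import Mathlib.Analysis.SpecialFunctions.Log.Summable
import Mathlib.NumberTheory.SumPrimeReciprocals
import HarnessLib

/-!
# Partial Euler products: absolute convergence of the Euler product for `Re s > 1`

Sibling proof file of `Literature.NumberTheory.LFunctions.PartialEulerProducts` (K. Conrad,
*Partial Euler products on the critical line*, Canad. J. Math. **57** (2005), §2: "The product
(2.1) converges absolutely for Re(s) > 1"). For a normalized datum `α` of degree `≤ d` over `ℚ`
and `Re s > 1`, the factors `L_p(s) = ∏_j (1 - α_{p,j} p^{-s})⁻¹` satisfy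
`∑_p ‖L_p(s) - 1‖ < ∞` (`summable_norm_eulerFactor_sub_one`), so the Euler product
`eulerProduct α s = ∏'_p L_p(s)` converges unconditionally (`hasProd_eulerProduct`) and the
partial Euler products over `p ≤ x` tend to it as `x → ∞` (`tendsto_partialProduct_eulerProduct`).
With this, a function `G` extends the Euler product `L(s)` from `Re s > 1` iff the partial products
converge to `G` there — the form in which the `O(1)`-version of Conrad's Theorem 5.3
(`Literature.NumberTheory.LFunctions.PartialEulerProductsProofs`) is stated. No definitions are
introduced. [folklore]

## References

* K. Conrad, *Partial Euler products on the critical line*, Canad. J. Math. 57 (2005) 267–297,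
  §2 (2.1). [cite: Conrad2005PartialEuler]
-/

noncomputable section

open scoped Topology
open Filter Finset Complex

namespace Literature.NumberTheory.LFunctions

namespace PartialEuler

variable {d : ℕ} {α : ℕ → Fin d → ℂ}

/-- For `‖z‖ ≤ 1/2`: `‖(1 - z)⁻¹ - 1‖ ≤ 2 ‖z‖`. [folklore] -/
theorem norm_inv_one_sub_sub_one_le {z : ℂ} (hz : ‖z‖ ≤ 1 / 2) : ‖(1 - z)⁻¹ - 1‖ ≤ 2 * ‖z‖ := by
  have h1 : 1 - z ≠ 0 := by
    intro h
    have hz1 : z = 1 := by linear_combination -h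
    rw [hz1, norm_one] at hz
    linarith
  have hkey : (1 - z)⁻¹ - 1 = z * (1 - z)⁻¹ := by field_simp; ring
  rw [hkey, norm_mul, norm_inv]
  have hlow : 1 / 2 ≤ ‖1 - z‖ := by
    have := norm_sub_norm_le (1 : ℂ) z
    rw [norm_one] at this
    linarith
  calc ‖z‖ * ‖1 - z‖⁻¹ ≤ ‖z‖ * (1 / 2)⁻¹ := by
        gcongr
      _ = 2 * ‖z‖ := by ring

/-- **The factors are summably close to `1`:** for `Re s > 1`,
`‖L_p(s) - 1‖ = ‖∏_j (1 - α_{p,j} p^{-s})⁻¹ - 1‖ ≤ (exp (2d) - 1) · p^{-Re s}`, a summable bound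
(`∑_p p^{-Re s} < ∞`). [cite: Conrad2005PartialEuler, §2] -/
theorem norm_eulerFactor_sub_one_le (hα : IsNormalized α) {p : ℕ} (hp : p.Prime) {s : ℂ}
    (hs : 1 < s.re) :
    ‖∏ j, (1 - α p j * (p : ℂ) ^ (-s))⁻¹ - 1‖ ≤ (Real.exp (2 * d) - 1) * (p : ℝ) ^ (-s.re) := by
  set q : ℝ := (p : ℝ) ^ (-s.re) with hq
  have hq0 : 0 ≤ q := by positivity
  have hq1 : q ≤ 1 / 2 := by
    calc q ≤ (2 : ℝ) ^ (-s.re) := prime_rpow_neg_le_two_rpow_neg hp (by linarith)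
      _ ≤ (2 : ℝ) ^ (-1 : ℝ) := Real.rpow_le_rpow_of_exponent_le (by norm_num) (by linarith)
      _ = 1 / 2 := by norm_num
  -- write each factor as `1 + w_j`, `‖w_j‖ ≤ 2q`
  have hw : ∀ j, ‖(1 - α p j * (p : ℂ) ^ (-s))⁻¹ - 1‖ ≤ 2 * q := fun j =>
    (norm_inv_one_sub_sub_one_le ((norm_mul_cpow_neg_le hα hp j s).trans hq1)).trans
      (by linarith [norm_mul_cpow_neg_le hα hp j s])
  have hprod : ∏ j, (1 - α p j * (p : ℂ) ^ (-s))⁻¹ =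
      ∏ j, (1 + ((1 - α p j * (p : ℂ) ^ (-s))⁻¹ - 1)) := by
    refine Finset.prod_congr rfl fun j _ => by ring
  rw [hprod]
  refine (Finset.norm_prod_one_add_sub_one_le _ _).trans ?_
  have hsum : ∑ j, ‖(1 - α p j * (p : ℂ) ^ (-s))⁻¹ - 1‖ ≤ 2 * d * q := by
    calc ∑ j, ‖(1 - α p j * (p : ℂ) ^ (-s))⁻¹ - 1‖ ≤ ∑ _j : Fin d, 2 * q :=
          Finset.sum_le_sum fun j _ => hw j
      _ = 2 * d * q := by
          rw [Finset.sum_const, Finset.card_univ, Fintype.card_fin, nsmul_eq_mul]; ring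
  -- `exp(2dq) - 1 ≤ q (exp(2d) - 1)` by convexity (`q ≤ 1`)
  have hconv : Real.exp (2 * d * q) - 1 ≤ (Real.exp (2 * d) - 1) * q := by
    have hq1' : q ≤ 1 := by linarith
    -- `exp (t x) ≤ (1 - t) + t exp x` for `t ∈ [0,1]`, i.e. convexity of `exp` on `[0, x]`
    have := (convexOn_exp.2 (Set.mem_univ (0 : ℝ)) (Set.mem_univ (2 * (d : ℝ))) (by linarith) hq0
      (by ring : 1 - q + q = 1))
    simp only [smul_eq_mul, mul_zero, zero_add, Real.exp_zero, mul_one] at this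
    calc Real.exp (2 * d * q) - 1 = Real.exp (q * (2 * d)) - 1 := by ring_nf
      _ ≤ (1 - q + q * Real.exp (2 * d)) - 1 := by linarith
      _ = (Real.exp (2 * d) - 1) * q := by ring
  calc Real.exp (∑ j, ‖(1 - α p j * (p : ℂ) ^ (-s))⁻¹ - 1‖) - 1 ≤ Real.exp (2 * d * q) - 1 := by
        gcongr
    _ ≤ (Real.exp (2 * d) - 1) * q := hconv

/-- `∑_p ‖L_p(s) - 1‖ < ∞` for `Re s > 1`. [cite: Conrad2005PartialEuler, §2] -/
theorem summable_norm_eulerFactor_sub_one (hα : IsNormalized α) {s : ℂ} (hs : 1 < s.re) :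
    Summable fun p : Nat.Primes => ‖∏ j, (1 - α p j * ((p : ℕ) : ℂ) ^ (-s))⁻¹ - 1‖ := by
  refine Summable.of_nonneg_of_le (fun _ => norm_nonneg _)
    (fun p => norm_eulerFactor_sub_one_le hα p.2 hs) ?_
  exact (Nat.Primes.summable_rpow.mpr (by linarith)).mul_left _

/-- **The Euler product converges for `Re s > 1`** (unconditionally, over the primes):
`HasProd (p ↦ L_p(s)) (eulerProduct α s)`. [cite: Conrad2005PartialEuler, §2] -/
theorem hasProd_eulerProduct (hα : IsNormalized α) {s : ℂ} (hs : 1 < s.re) :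
    HasProd (fun p : Nat.Primes => ∏ j, (1 - α p j * ((p : ℕ) : ℂ) ^ (-s))⁻¹) (eulerProduct α s) := by
  have hmul : Multipliable fun p : Nat.Primes => ∏ j, (1 - α p j * ((p : ℕ) : ℂ) ^ (-s))⁻¹ := by
    have h := multipliable_one_add_of_summable (summable_norm_eulerFactor_sub_one hα hs)
    refine h.congr fun p => ?_
    ring
  exact hmul.hasProd

/-- **The partial Euler products tend to the Euler product** for `Re s > 1`:
`∏_{p ≤ x} L_p(s) → ∏'_p L_p(s)` as `x → ∞`. [cite: Conrad2005PartialEuler, §2] -/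
theorem tendsto_partialProduct_eulerProduct (hα : IsNormalized α) {s : ℂ} (hs : 1 < s.re) :
    Tendsto (fun x : ℝ => partialProduct α s x) atTop (𝓝 (eulerProduct α s)) := by
  set f : ℕ → ℂ := fun p => ∏ j, (1 - α p j * (p : ℂ) ^ (-s))⁻¹ with hf
  have h := hasProd_eulerProduct hα hs
  -- as an `ℕ`-indexed product with the prime indicator
  have h' : HasProd ({p : ℕ | p.Prime}.mulIndicator f) (eulerProduct α s) := by
    rw [← hasProd_subtype_iff_mulIndicator]
    exact h
  have hnat := h'.tendsto_prod_nat
  have hrange : ∀ n : ℕ, ∏ i ∈ Finset.range n, {p : ℕ | p.Prime}.mulIndicator f i =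
      ∏ p ∈ Nat.primesBelow n, f p := fun n =>
    Finset.prod_mulIndicator_eq_prod_filter (Finset.range n) (fun _ => f) (fun _ => {p | p.Prime}) id
  simp_rw [hrange] at hnat
  -- `primesLE ⌊x⌋₊ = primesBelow (⌊x⌋₊ + 1)`
  have hidx : Tendsto (fun x : ℝ => ⌊x⌋₊ + 1) atTop atTop :=
    (tendsto_add_atTop_nat 1).comp (tendsto_nat_floor_atTop (α := ℝ))
  refine (hnat.comp hidx).congr fun x => ?_
  simp only [Function.comp_apply, partialProduct, Nat.primesLE, hf]

/-- Hence, for `Re s > 1`, a value `G s` is the Euler product iff the partial Euler products tend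
to it. [folklore] -/
theorem tendsto_partialProduct_iff_eq_eulerProduct (hα : IsNormalized α) {s : ℂ} (hs : 1 < s.re)
    {G : ℂ} : Tendsto (fun x : ℝ => partialProduct α s x) atTop (𝓝 G) ↔ G = eulerProduct α s :=
  ⟨fun h => tendsto_nhds_unique h (tendsto_partialProduct_eulerProduct hα hs),
    fun h => h ▸ tendsto_partialProduct_eulerProduct hα hs⟩

end PartialEuler

end Literature.NumberTheory.LFunctions

end
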